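import Mathlib.Analysis.Fourier.PoissonSummation
import Mathlib.Analysis.Fourier.FourierTransformDeriv
import Mathlib.Analysis.Calculus.ContDiff.Bounds
import HarnessLib

/-!
# Poisson summation along an arithmetic progression and Fourier decay for smooth compactly supported functions

Family `parity`, statement parity.S17; analytic toolkit for FI Lemma 3.1. Source for the use:
J. Friedlander, H. Iwaniec, *The polynomial `X² + Y⁴` captures its primes*, Ann. of Math. (2) 148
(1998), 945–1040 [FriedlanderIwaniecAnnals1998], §3, proof of Lemma 3.1, (3.11): "For the nonzero
values of `b` we expand the above inner sum into Fourier series by Poisson's formula getting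
`∑_{a ≡ α (d)} f(a² + b²) = d⁻¹ ∑_k e(αk/d) ∫ f(t² + b²) e(tk/d) dt`" and the estimate of the
Fourier integrals "by repeated partial integration".

Everything here is standard Fourier analysis on `ℝ`, PROVED from Mathlib's one-dimensional Poisson
summation formula (`Real.tsum_eq_tsum_fourier_of_rpow_decay`) and the Fourier transform of
iterated derivatives (`Real.fourier_iteratedDeriv`), specialised to smooth compactly supported
`F : ℝ → ℂ` (for which all hypotheses are automatic):

* `hasCompactSupport_iteratedDeriv`, `isBigO_cocompact_of_hasCompactSupport`;
* **`pow_mul_norm_fourier_le`** (repeated partial integration):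
  `(2π|ξ|)ⁿ |𝓕F(ξ)| ≤ ∫ |F⁽ⁿ⁾|` for every `n`;
* `fourier_comp_affine` : for `G(u) = F(α + du)` (`d > 0`),
  `𝓕G(ξ) = d⁻¹ e(αξ/d) 𝓕F(ξ/d)`;
* **`tsum_arithProg_eq_tsum_fourier`** (Poisson summation along `a ≡ α (mod d)`):
  `∑_{m ∈ ℤ} F(α + dm) = d⁻¹ ∑_{k ∈ ℤ} e(αk/d) 𝓕F(k/d)`.

## References

* J. Friedlander, H. Iwaniec, Ann. of Math. (2) 148 (1998), 945–1040, §3 (3.11).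
  [cite: FriedlanderIwaniecAnnals1998, §3 (3.11)]
* E. M. Stein, G. Weiss, *Introduction to Fourier Analysis on Euclidean Spaces*, Cor. VII.2.6
  (Poisson summation; the source of Mathlib's `Real.tsum_eq_tsum_fourier_of_rpow_decay`).

## Mathlib search

Mathlib: `Real.tsum_eq_tsum_fourier_of_rpow_decay`, `Real.fourier_iteratedDeriv`,
`VectorFourier.norm_fourierIntegral_le_integral_norm`, `Real.fourier_real_eq`,
`MeasureTheory.Measure.integral_comp_mul_left`, `MeasureTheory.integral_add_left_eq_self`,
`HasCompactSupport.comp_homeomorph`, `hasCompactSupport_iff_eventuallyEq`. No Poisson formula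
along arithmetic progressions and no packaged decay estimate for compactly supported smooth
functions exist in Mathlib or the tree (`lean search 'arithProg.*fourier|Poisson.*progression'`).
-/

noncomputable section

open Real MeasureTheory Filter Complex
open scoped FourierTransform Topology ContDiff ComplexConjugate

namespace Literature.NumberTheory.Sieve.FriedlanderIwaniecPrimes

variable {F : ℝ → ℂ}

/-! ### Compact support -/

/-- The iterated derivatives of a compactly supported function have compact support. [folklore] -/
theorem hasCompactSupport_iteratedDeriv (hFc : HasCompactSupport F) (n : ℕ) :
    HasCompactSupport (iteratedDeriv n F) := by
  induction n with
  | zero => simpa using hFc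
  | succ n ih => rw [iteratedDeriv_succ]; exact ih.deriv

/-- A compactly supported function is `O(g)` along the cocompact filter, for any `g`. [folklore] -/
theorem isBigO_cocompact_of_hasCompactSupport (hFc : HasCompactSupport F) (g : ℝ → ℝ) :
    F =O[cocompact ℝ] g := by
  have h : F =ᶠ[cocompact ℝ] 0 := by
    rw [← coclosedCompact_eq_cocompact]
    exact hasCompactSupport_iff_eventuallyEq.mp hFc
  exact (Asymptotics.isBigO_zero g (cocompact ℝ)).congr' h.symm EventuallyEq.rfl

/-- The iterated derivatives of a smooth compactly supported function are integrable. [folklore] -/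
theorem integrable_iteratedDeriv (hF : ContDiff ℝ ∞ F) (hFc : HasCompactSupport F) (n : ℕ) :
    Integrable (iteratedDeriv n F) :=
  (hF.continuous_iteratedDeriv n (by exact_mod_cast le_top)).integrable_of_hasCompactSupport
    (hasCompactSupport_iteratedDeriv hFc n)

/-! ### Fourier decay by repeated partial integration -/

/-- **Repeated partial integration.** For a smooth compactly supported `F : ℝ → ℂ`, every `n` and
every `ξ`: `(2π|ξ|)ⁿ |𝓕F(ξ)| ≤ ∫ |F⁽ⁿ⁾(t)| dt` (from `𝓕(F⁽ⁿ⁾)(ξ) = (2πiξ)ⁿ 𝓕F(ξ)`,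
Mathlib `Real.fourier_iteratedDeriv`, and `|𝓕g| ≤ ‖g‖₁`). This is the estimate behind FI's
"`I(k, b; d) ≪ √x (d√x/(ky))ʲ` for any `j ≥ 0`". [cite: FriedlanderIwaniecAnnals1998, §3, display after (3.12)] -/
theorem pow_mul_norm_fourier_le (hF : ContDiff ℝ ∞ F) (hFc : HasCompactSupport F) (n : ℕ)
    (ξ : ℝ) : (2 * π * |ξ|) ^ n * ‖𝓕 F ξ‖ ≤ ∫ t, ‖iteratedDeriv n F t‖ := by
  have h := Real.fourier_iteratedDeriv (N := (⊤ : ℕ∞)) (n := n) hF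
    (fun m _ => integrable_iteratedDeriv hF hFc m) (by exact_mod_cast le_top)
  have h' := congrFun h ξ
  calc (2 * π * |ξ|) ^ n * ‖𝓕 F ξ‖ = ‖(2 * π * I * ξ) ^ n • 𝓕 F ξ‖ := by
        rw [norm_smul, norm_pow]
        congr 2
        simp [abs_of_pos pi_pos]
    _ = ‖𝓕 (iteratedDeriv n F) ξ‖ := by rw [h']
    _ ≤ ∫ t, ‖iteratedDeriv n F t‖ :=
        VectorFourier.norm_fourierIntegral_le_integral_norm 𝐞 volume (innerₗ ℝ) _ ξ

/-- The decay in the form used for Poisson summation: `𝓕F = O(|ξ|⁻²)` at infinity. [folklore] -/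
theorem fourier_isBigO_rpow_neg_two (hF : ContDiff ℝ ∞ F) (hFc : HasCompactSupport F) :
    𝓕 F =O[cocompact ℝ] fun ξ : ℝ => |ξ| ^ (-2 : ℝ) := by
  set M : ℝ := ∫ t, ‖iteratedDeriv 2 F t‖ with hM
  refine Asymptotics.IsBigO.of_bound (M / (2 * π) ^ 2) ?_
  have hmem : (Metric.closedBall (0 : ℝ) 1)ᶜ ∈ cocompact ℝ :=
    (isCompact_closedBall (0 : ℝ) 1).compl_mem_cocompact
  filter_upwards [hmem] with ξ hξ
  simp only [Set.mem_compl_iff, Metric.mem_closedBall, dist_zero_right, Real.norm_eq_abs,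
    not_le] at hξ
  have hξ0 : 0 < |ξ| := zero_lt_one.trans hξ
  have hb := pow_mul_norm_fourier_le hF hFc 2 ξ
  rw [Real.norm_eq_abs, abs_of_pos (Real.rpow_pos_of_pos hξ0 _), Real.rpow_neg hξ0.le,
    Real.rpow_two]
  rw [mul_pow] at hb
  have h2 : 0 < (2 * π) ^ 2 * |ξ| ^ 2 := by positivity
  rw [show M / (2 * π) ^ 2 * (|ξ| ^ 2)⁻¹ = M / ((2 * π) ^ 2 * |ξ| ^ 2) by field_simp,
    le_div_iff₀ h2]
  calc ‖𝓕 F ξ‖ * ((2 * π) ^ 2 * |ξ| ^ 2) = (2 * π) ^ 2 * |ξ| ^ 2 * ‖𝓕 F ξ‖ := by ring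
    _ ≤ M := hb

/-! ### Dilation and translation -/

/-- **The Fourier transform of `u ↦ F(α + du)`** (`d > 0`): `𝓕G(ξ) = d⁻¹ e(αξ/d) 𝓕F(ξ/d)`.
[folklore] -/
theorem fourier_comp_affine (F : ℝ → ℂ) {d : ℝ} (hd : 0 < d) (α ξ : ℝ) :
    𝓕 (fun u : ℝ => F (α + d * u)) ξ = (d : ℂ)⁻¹ * (𝐞 (α * ξ / d) : ℂ) * 𝓕 F (ξ / d) := by
  rw [Real.fourier_real_eq, Real.fourier_real_eq]
  -- the integrand as a function of `v = α + du`
  set φ : ℝ → ℂ := fun v => 𝐞 (-((v - α) / d * ξ)) • F v with hφ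
  have h1 : (fun u : ℝ => 𝐞 (-(u * ξ)) • F (α + d * u)) = fun u => (fun w => φ (α + w)) (d * u) := by
    funext u
    simp only [hφ]
    congr 2
    field_simp
    ring
  rw [h1, Measure.integral_comp_mul_left (fun w => φ (α + w)) d, integral_add_left_eq_self φ α]
  have h2 : ∀ v : ℝ, φ v = (𝐞 (α * ξ / d) : ℂ) * (𝐞 (-(v * (ξ / d))) • F v) := by
    intro v
    simp only [hφ, Circle.smul_def, smul_eq_mul, ← mul_assoc, ← Circle.coe_mul,
      ← AddChar.map_add_eq_mul]
    congr 3
    field_simp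
    ring
  simp_rw [h2]
  rw [integral_const_mul, abs_of_pos (inv_pos.mpr hd), Complex.real_smul]
  push_cast
  ring

/-! ### Poisson summation along an arithmetic progression -/

/-- **Poisson summation along `a ≡ α (mod d)`**: for a smooth compactly supported `F : ℝ → ℂ`,
`d ≥ 1` and `α ∈ ℤ`,
`∑_{m ∈ ℤ} F(α + dm) = d⁻¹ ∑_{k ∈ ℤ} e(αk/d) 𝓕F(k/d)`
(FI (3.11): "`∑_{a ≡ α (d)} f(a² + b²) = d⁻¹ ∑_k e(αk/d) ∫ f(t² + b²) e(tk/d) dt`"; Mathlib's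
`𝓕F(ξ) = ∫ F(t) e(-tξ) dt`, and for the even functions of FI the sign is immaterial). Both series
converge absolutely (the left one is a finite sum). [cite: FriedlanderIwaniecAnnals1998, §3 (3.11)] -/
theorem tsum_arithProg_eq_tsum_fourier (hF : ContDiff ℝ ∞ F) (hFc : HasCompactSupport F)
    {d : ℕ} (hd : 0 < d) (α : ℤ) :
    ∑' m : ℤ, F (α + d * m) =
      (d : ℂ)⁻¹ * ∑' k : ℤ, (𝐞 ((α : ℝ) * k / d) : ℂ) * 𝓕 F ((k : ℝ) / d) := by
  have hdr : (0 : ℝ) < d := by exact_mod_cast hd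
  set G : ℝ → ℂ := fun u => F (α + d * u) with hG
  -- `G` is smooth with compact support
  have hGd : ContDiff ℝ ∞ G :=
    hF.comp (contDiff_const.add (contDiff_const.mul contDiff_id))
  have hGc : HasCompactSupport G := by
    have h := hFc.comp_homeomorph ((Homeomorph.mulLeft₀ (d : ℝ) hdr.ne').trans
      (Homeomorph.addLeft (α : ℝ)))
    have hGeq : G = F ∘ ⇑((Homeomorph.mulLeft₀ (d : ℝ) hdr.ne').trans
        (Homeomorph.addLeft (α : ℝ))) := by
      funext u
      rfl
    rw [hGeq]
    exact h
  -- Poisson summation for `G` at `x = 0`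
  have hP := Real.tsum_eq_tsum_fourier_of_rpow_decay hGd.continuous one_lt_two
    (isBigO_cocompact_of_hasCompactSupport hGc _) (fourier_isBigO_rpow_neg_two hGd hGc) 0
  simp only [zero_add, QuotientAddGroup.mk_zero, fourier_eval_zero, mul_one] at hP
  have hP' : ∑' n : ℤ, G n = ∑' n : ℤ, 𝓕 G n := hP
  -- identify both sides
  calc ∑' m : ℤ, F (α + d * m) = ∑' n : ℤ, G n := rfl
    _ = ∑' n : ℤ, 𝓕 G n := hP'
    _ = ∑' k : ℤ, (d : ℂ)⁻¹ * ((𝐞 ((α : ℝ) * k / d) : ℂ) * 𝓕 F ((k : ℝ) / d)) := by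
        refine tsum_congr fun k => ?_
        rw [hG, fourier_comp_affine F hdr, mul_assoc]
        push_cast
        ring
    _ = (d : ℂ)⁻¹ * ∑' k : ℤ, (𝐞 ((α : ℝ) * k / d) : ℂ) * 𝓕 F ((k : ℝ) / d) := tsum_mul_left

/-! ### Pointwise bounds, summability and tails of `k ↦ 𝓕F(k/d)` -/

/-- `|𝓕F(ξ)| ≤ ‖F‖₁`. [folklore] -/
theorem norm_fourier_le_integral_norm (F : ℝ → ℂ) (ξ : ℝ) : ‖𝓕 F ξ‖ ≤ ∫ t, ‖F t‖ :=
  VectorFourier.norm_fourierIntegral_le_integral_norm 𝐞 volume (innerₗ ℝ) F ξ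

/-- `|𝓕F(ξ)| ≤ ‖F⁽ⁿ⁾‖₁ / (2π|ξ|)ⁿ` for `ξ ≠ 0`. [folklore] -/
theorem norm_fourier_le_div (hF : ContDiff ℝ ∞ F) (hFc : HasCompactSupport F) (n : ℕ) {ξ : ℝ}
    (hξ : ξ ≠ 0) : ‖𝓕 F ξ‖ ≤ (∫ t, ‖iteratedDeriv n F t‖) / (2 * π * |ξ|) ^ n := by
  rw [le_div_iff₀ (by positivity), mul_comm]
  exact pow_mul_norm_fourier_le hF hFc n ξ

/-- For `k ≥ 1`, `d > 0`: `|𝓕F(k/d)| ≤ ‖F⁽ⁿ⁾‖₁ (d/(2π))ⁿ k⁻ⁿ`. [folklore] -/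
theorem norm_fourier_div_le (hF : ContDiff ℝ ∞ F) (hFc : HasCompactSupport F) (n : ℕ) {d : ℝ}
    (hd : 0 < d) {k : ℝ} (hk : 0 < |k|) :
    ‖𝓕 F (k / d)‖ ≤ (∫ t, ‖iteratedDeriv n F t‖) * (d / (2 * π)) ^ n * (|k| ^ n)⁻¹ := by
  have hξ : k / d ≠ 0 := div_ne_zero (abs_pos.mp hk) hd.ne'
  refine (norm_fourier_le_div hF hFc n hξ).trans (le_of_eq ?_)
  rw [abs_div, abs_of_pos hd]
  field_simp
  rw [mul_assoc, ← mul_pow, show 2 * π * |k| / d * (d / (2 * π)) = |k| by field_simp]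

/-- **Summability of `k ↦ 𝓕F(k/d)` over `ℤ`** (from the decay `O(k⁻²)`). [folklore] -/
theorem summable_fourier_div (hF : ContDiff ℝ ∞ F) (hFc : HasCompactSupport F) {d : ℝ}
    (hd : 0 < d) : Summable fun k : ℤ => 𝓕 F ((k : ℝ) / d) := by
  refine summable_of_isBigO (Real.summable_abs_int_rpow one_lt_two) ?_
  refine Asymptotics.IsBigO.of_bound ((∫ t, ‖iteratedDeriv 2 F t‖) * (d / (2 * π)) ^ 2) ?_
  have hmem : {k : ℤ | k ≤ -1 ∨ 1 ≤ k} ∈ (cofinite : Filter ℤ) := by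
    rw [Int.cofinite_eq, Filter.mem_sup]
    exact ⟨Filter.mem_of_superset (Filter.mem_atBot (-1)) fun k hk => Or.inl hk,
      Filter.mem_of_superset (Filter.mem_atTop 1) fun k hk => Or.inr hk⟩
  filter_upwards [hmem] with k hk
  have hk0 : 0 < |(k : ℝ)| := by
    rcases hk with h | h
    · have : (k : ℝ) ≤ -1 := by exact_mod_cast h
      rw [abs_pos]; linarith
    · have : (1 : ℝ) ≤ k := by exact_mod_cast h
      rw [abs_pos]; linarith
  refine (norm_fourier_div_le hF hFc 2 hd hk0).trans (le_of_eq ?_)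
  rw [Real.norm_eq_abs, abs_of_pos (Real.rpow_pos_of_pos hk0 _), Real.rpow_neg hk0.le,
    Real.rpow_two]

/-- `∑_{K < k ≤ N} k⁻ⁿ ≤ K^{1-n}` for `n ≥ 2`, `K ≥ 1` (compare `k⁻ⁿ ≤ K^{2-n} k⁻²` and
`∑_{k > K} k⁻² ≤ K⁻¹`). [folklore] -/
theorem sum_Ioc_inv_pow_le {n K : ℕ} (hn : 2 ≤ n) (hK : 1 ≤ K) (N : ℕ) :
    ∑ k ∈ Finset.Ioc K N, ((k : ℝ) ^ n)⁻¹ ≤ ((K : ℝ) ^ (n - 1))⁻¹ := by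
  have hKr : (0 : ℝ) < K := by exact_mod_cast hK
  rcases le_or_gt N K with hNK | hNK
  · rw [Finset.Ioc_eq_empty (by omega), Finset.sum_empty]
    positivity
  calc ∑ k ∈ Finset.Ioc K N, ((k : ℝ) ^ n)⁻¹
      ≤ ∑ k ∈ Finset.Ioc K N, ((K : ℝ) ^ (n - 2))⁻¹ * ((k : ℝ) ^ 2)⁻¹ := by
        refine Finset.sum_le_sum fun k hk => ?_
        rw [Finset.mem_Ioc] at hk
        have hkr : (K : ℝ) ≤ k := by exact_mod_cast hk.1.le
        have hk0 : (0 : ℝ) < k := hKr.trans_le hkr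
        rw [← mul_inv, show (k : ℝ) ^ n = (k : ℝ) ^ (n - 2) * (k : ℝ) ^ 2 by
          rw [← pow_add]; congr 1; omega]
        gcongr
    _ = ((K : ℝ) ^ (n - 2))⁻¹ * ∑ k ∈ Finset.Ioc K N, ((k : ℝ) ^ 2)⁻¹ := (Finset.mul_sum _ _ _).symm
    _ ≤ ((K : ℝ) ^ (n - 2))⁻¹ * (K : ℝ)⁻¹ := by
        refine mul_le_mul_of_nonneg_left ?_ (by positivity)
        have h := sum_Ioc_inv_sq_le_sub (α := ℝ) (by omega : K ≠ 0) hNK.le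
        have : (0 : ℝ) ≤ (N : ℝ)⁻¹ := by positivity
        linarith
    _ = ((K : ℝ) ^ (n - 1))⁻¹ := by
        rw [← mul_inv, ← pow_succ]
        congr 2
        omega

/-- **The tail of the dual sum** (repeated partial integration, summed): for `n ≥ 2`, `d > 0`,
`1 ≤ K ≤ N`,
`∑_{K < |k| ≤ N} |𝓕F(k/d)| ≤ 2 ‖F⁽ⁿ⁾‖₁ (d/(2π))ⁿ K^{1-n}`.
[cite: FriedlanderIwaniecAnnals1998, §3, "Estimating the tail of the Fourier series (3.11) trivially"] -/
theorem sum_tail_norm_fourier_div_le (hF : ContDiff ℝ ∞ F) (hFc : HasCompactSupport F) {n : ℕ}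
    (hn : 2 ≤ n) {d : ℝ} (hd : 0 < d) {K : ℕ} (hK : 1 ≤ K) (N : ℕ) :
    ∑ k ∈ Finset.Ioc K N, (‖𝓕 F ((k : ℝ) / d)‖ + ‖𝓕 F (-(k : ℝ) / d)‖) ≤
      2 * (∫ t, ‖iteratedDeriv n F t‖) * (d / (2 * π)) ^ n * ((K : ℝ) ^ (n - 1))⁻¹ := by
  set M : ℝ := (∫ t, ‖iteratedDeriv n F t‖) * (d / (2 * π)) ^ n with hM
  have hM0 : 0 ≤ M := by positivity
  calc ∑ k ∈ Finset.Ioc K N, (‖𝓕 F ((k : ℝ) / d)‖ + ‖𝓕 F (-(k : ℝ) / d)‖)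
      ≤ ∑ k ∈ Finset.Ioc K N, 2 * M * ((k : ℝ) ^ n)⁻¹ := by
        refine Finset.sum_le_sum fun k hk => ?_
        rw [Finset.mem_Ioc] at hk
        have hk0 : 0 < |(k : ℝ)| := by
          rw [abs_pos]; exact_mod_cast (show k ≠ 0 by omega)
        have hk0' : 0 < |(-(k : ℝ))| := by rwa [abs_neg]
        have h1 := norm_fourier_div_le hF hFc n hd hk0
        have h2 := norm_fourier_div_le hF hFc n hd hk0'
        rw [abs_neg] at h2
        rw [Nat.abs_cast] at h1 h2
        rw [hM]
        linarith
    _ = 2 * M * ∑ k ∈ Finset.Ioc K N, ((k : ℝ) ^ n)⁻¹ := (Finset.mul_sum _ _ _).symm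
    _ ≤ 2 * M * ((K : ℝ) ^ (n - 1))⁻¹ :=
        mul_le_mul_of_nonneg_left (sum_Ioc_inv_pow_le hn hK N) (by positivity)
    _ = _ := by rw [hM]; ring

/-! ### Real-valued functions -/

/-- For a real-valued `F`, `𝓕F(-ξ) = conj 𝓕F(ξ)`. [folklore] -/
theorem fourier_neg_eq_conj (g : ℝ → ℝ) (ξ : ℝ) :
    𝓕 (fun t => (g t : ℂ)) (-ξ) = conj (𝓕 (fun t => (g t : ℂ)) ξ) := by
  rw [Real.fourier_real_eq, Real.fourier_real_eq, ← integral_conj]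
  refine integral_congr_ae (Filter.Eventually.of_forall fun v => ?_)
  simp only [Circle.smul_def, smul_eq_mul, map_mul, Complex.conj_ofReal, ← Circle.coe_inv_eq_conj,
    ← AddChar.map_neg_eq_inv, mul_neg, neg_neg]

end Literature.NumberTheory.Sieve.FriedlanderIwaniecPrimes
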